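import Summits.BirchSwinnertonDyer.Rank1Residual.JET.RingClassTransverseLagrangian
import HarnessLib

/-!
# T1 JET (cell `bsd-jet`), road K: the binder `h𝒯sd` of `JET.tamagawaExponent_le_mInfty_of_localFacts'`
# BY NAME, in that theorem's own currency (typer seat `bsd-jet-ty` g7; 0 classes move)

HONEST FRAMING (programme file §HONESTY, verbatim): «no tranche here proves BSD; ARM L moves the
LITERAL column of an r ≤ 1 census into the kernel-proved-modulo-named-print column.» THEOREMS ONLY
(no definition, no named fact, no `sorry`); nothing is booked; typed ≠ proved ≠ endorsed.

WHAT. `JET.RingClassTransverse.localTransverseFamily_selfDual` is the binder `h𝒯sd` of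
`JET.tamagawaExponent_le_mInfty_of_localFacts'` (`Theorems/Rank1ResidualJetThm63LocalFactsPrime`, lines
106–124) VERBATIM — «the intrinsic transverse condition `⨅_{ℓ ∣ c, ℓ ∈ v} ⨅_{w' ∣ v} H¹_tr(K_v → K[ℓ]_{w'}, E[p^k])`
is LAGRANGIAN for the local Tate pairing at every `v ∣ c`» (Howard 2004 Prop. 2.1.9 (ii) = Mazur–Rubin
Prop. 1.3.2 (ii) for `L = K[ℓ]_λ`; Jetchev 2008 §3.1.2 «self-dual with respect to the Tate local pairing») —
stated over EXACTLY that theorem's context: `hK`, `hD3 : d_K ≠ −3`, `hD4 : d_K ≠ −4`, `ι`, `p ≠ 2`, `k` with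
`[NeZero (p ^ k)] [Finite E[p^k]]`, the level `c : {c // Squarefree c ∧ ∀ ℓ ∣ c, Zhang–Kolyvagin}`, `1 ≤ k`,
`mInf` and `hkM : k + mInf ≤ M(c)`.  PLUG: `h𝒯sd := JET.RingClassTransverse.localTransverseFamily_selfDual W K hK
hD3 hD4 ι p hp2 k c hk mInf hkM`.  Proof = the sibling `dualTransported_eq_of_localTransverseFamily`
(`JET/RingClassTransverseLagrangian`) after `d_K < −4` (`|d_K| > 2`, Minkowski) and `k ≤ M(ℓ)` for `ℓ ∣ c`
(`Zhang2014.natCast_le_levelIndex_iff`).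

References: [cite: Howard2004HeegnerKolyvagin, Prop. 2.1.9 (ii), §2.2] [cite: MazurRubin2004, Prop. 1.3.2 (ii)
(p. 12)] [cite: Jetchev2008, §3.1.2 (p. 814)] [cite: WZhang2014, Notations (xii)] [cite: GrossLMS1991, §1, §3].

## Tree search
`lean search 'dualTransported.*transverse|localTransverseFamily|h𝒯sd'`: only the sibling
`dualTransported_eq_of_localTransverseFamily` (hypotheses `hD : d_K < −4`, `hkM : ∀ ℓ ∣ c, k ≤ M(ℓ)`); this file
is its re-keying to the consumer's binders, nothing else.
-/

set_option autoImplicit false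

noncomputable section

open scoped Classical Pointwise

namespace Summit.BirchSwinnertonDyer.Rank1Residual.JET.RingClassTransverse

open CategoryTheory ContinuousCohomology WeierstrassCurve Field Function NumberField IsDedekindDomain
open Literature.NumberTheory.EllipticCurves Literature.NumberTheory.EllipticCurves.Jetchev2008
open Literature.NumberTheory.GaloisRepresentations Literature.NumberTheory.GaloisCohomology
open Literature.NumberTheory.GaloisRepresentations.DiscreteGaloisModule (transverseSubgroup SelmerStructure)
open Literature.NumberTheory.Automorphic
open Summit.BirchSwinnertonDyer.Rank1Residual.JET.SelmerVocabulary
open scoped ContRepresentation NumberField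

variable (W : WeierstrassCurve ℚ) [W.IsElliptic] [W.IsGloballyMinimal] (K : Type) [Field K] [NumberField K]

/-- **T1 BY NAME — the binder `h𝒯sd` of `JET.tamagawaExponent_le_mInfty_of_localFacts'`, verbatim, over that
theorem's context.**  For `W/ℚ` elliptic globally minimal, `K` imaginary quadratic with `d_K ≠ −3, −4`,
`ι : K → ℂ`, an odd prime `p`, a level `k ≥ 1` with `k + m_∞ ≤ M(c)` for the square-free Zhang–Kolyvagin level
`c`: every Selmer structure `𝒯` whose finite-place conditions are the intrinsic transverse `⨅` is SELF-DUAL at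
every `v ∣ c` for every Weil datum and every perfect family of local invariants:
`inv.dualTransported 𝒯 (weilDualIntertwining …) (Sum.inr v) = 𝒯 (Sum.inr v)`.
PLUG: `h𝒯sd := localTransverseFamily_selfDual W K hK hD3 hD4 ι p hp2 k c hk mInf hkM`.
[cite: Howard2004HeegnerKolyvagin, Prop. 2.1.9 (ii)] [cite: MazurRubin2004, Prop. 1.3.2 (ii) (p. 12)]
[cite: Jetchev2008, §3.1.2 (p. 814)] -/
theorem localTransverseFamily_selfDual (hK : IsImaginaryQuadratic K)
    (hD3 : NumberField.discr K ≠ -3) (hD4 : NumberField.discr K ≠ -4) (ι : K →+* ℂ)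
    [∀ j : ℕ, NumberField (ringClassField K ι j)]
    (p : ℕ) [Fact p.Prime] (hp2 : p ≠ 2) (k : ℕ) [NeZero (p ^ k)]
    [Finite (geomTorsion (W.baseChange K) ((p ^ k : ℕ) : ℤ))]
    (c : {c : ℕ // Squarefree c ∧ ∀ ℓ ∈ c.primeFactors,
        Zhang2014.IsKolyvaginPrime (W.conductorNorm ℤ) W K p ℓ})
    (hk : 1 ≤ k) (mInf : ℕ) (hkM : (k : ℕ∞) + mInf ≤ Zhang2014.levelIndex W p c.1) :
    ∀ (𝒯 : SelmerStructure ((W.baseChange K).torsionGaloisModule ((p ^ k : ℕ) : ℤ))),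
      (∀ v : HeightOneSpectrum (𝓞 K), 𝒯 (Sum.inr v) =
        ⨅ ℓ ∈ c.1.primeFactors.filter (fun ℓ : ℕ ↦ ((ℓ : ℕ) : 𝓞 K) ∈ v.asIdeal),
          ⨅ (w' : HeightOneSpectrum (𝓞 (ringClassField K ι ℓ))) (_ : w'.asIdeal.LiesOver v.asIdeal),
            letI := (adicCompletionOfLiesOver K (ringClassField K ι ℓ) v w').toAlgebra
            transverseSubgroup (GaloisRep.toLocal v ((W.baseChange K).torsionGaloisModule ((p ^ k : ℕ) : ℤ)))
              (w'.adicCompletion (ringClassField K ι ℓ))) →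
      ∀ (e : geomTorsion (W.baseChange K) ((p ^ k : ℕ) : ℤ) →
          geomTorsion (W.baseChange K) ((p ^ k : ℕ) : ℤ) → AlgebraicClosure K)
        (hμ : ∀ S T, e S T ^ (p ^ k) = 1)
        (hadd₁ : ∀ S₁ S₂ T, e (S₁ + S₂) T = e S₁ T * e S₂ T)
        (hadd₂ : ∀ S T₁ T₂, e S (T₁ + T₂) = e S T₁ * e S T₂)
        (hgal : ∀ (g : absoluteGaloisGroup K) (S T : geomTorsion (W.baseChange K) ((p ^ k : ℕ) : ℤ)),
          g • e S T = e (g • S) (g • T)),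
      (∀ T, e T T = 1) → (∀ T, (∀ S, e S T = 1) → T = 0) →
      ∀ inv : LocalInvariants K (p ^ k), inv.IsPerfect → ∀ v ∈ placesDividing K c.1,
      inv.dualTransported 𝒯 (weilDualIntertwining (W.baseChange K) (p ^ k) e hμ hadd₁ hadd₂ hgal)
        (Sum.inr v) = 𝒯 (Sum.inr v) := by
  intro 𝒯 h𝒯 e hμ hadd₁ hadd₂ hgal halt hnondeg inv hperf v hv
  -- `d_K ∉ {−3, −4}` ⇒ `d_K < −4` (`d_K < 0`, `|d_K| > 2` by Minkowski), as in
  -- `X11b.KolyvaginAssembly.discr_lt_neg_four`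
  have hD : NumberField.discr K < -4 := by
    have hneg : NumberField.discr K < 0 := hK.discr_neg
    have habs : 2 < |NumberField.discr K| := NumberField.abs_discr_gt_two (by rw [hK.1]; omega)
    rw [abs_of_neg hneg] at habs
    omega
  -- `k ≤ k + m_∞ ≤ M(c)` ⇒ `k ≤ M(ℓ)` for every `ℓ ∣ c`
  have hkM' : ∀ ℓ ∈ c.1.primeFactors, k ≤ Zhang2014.kolyvaginIndex W p ℓ :=
    Zhang2014.natCast_le_levelIndex_iff.mp (le_self_add.trans hkM)
  exact dualTransported_eq_of_localTransverseFamily W K hK hD ι p hp2 k hk c.1 c.2.1 c.2.2 hkM' 𝒯 h𝒯 e hμ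
    hadd₁ hadd₂ hgal halt hnondeg inv hperf v hv

end Summit.BirchSwinnertonDyer.Rank1Residual.JET.RingClassTransverse

end
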